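import Summits.NavierStokesRegularity.NavierStokesRegularity.Theorems.SoloSalvageLucardoOlivaes2026GICavity
import HarnessLib

/-!
# C137 `LucardoOlivaes2026` (cell `ns-claims`, D-0090) — kernel NON-VACUITY GUARD for the token of record,
# part 2/3: the ring, the blob `F a = C + a • w`, the exact stretching identity, mirror conjugation

(Record: see part 1, `SoloSalvageLucardoOlivaes2026GICavity`.) This file: the stretching integrand
`sI v y = ⟪curl v y, Dv(y)(curl v y)⟫` (`stretchI v = ∫ sI v`, `stretchI_eq`); the C86 poloidal vortex ring `w`
of `SoloRefuteBledsoe2026Fields` is EVEN, hence `stretchI w = 0` (odd integrand under `x ↦ −x`), has enstrophy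
`Ew = ∫‖curl w‖² > 0` (C86 `curl_w_x₀_ne_zero`), no swirl, and axis velocity `w(0,0,ζ)₂ = 2G(ζ²) ≥ 0`; the
blob `F a = C + a • w` is smooth, compactly supported, divergence free, vanishes off radius `3/2`, and satisfies
the pointwise ZONE IDENTITY `sI (F a) = a²‖curl w‖² + a³·sI w + sI C` (inside the unit ball `DC = Dlin`
stretches the horizontal ring vorticity at unit rate and `curl C = 0`; outside radius `1/√2` the ring vanishes
with its derivative), whence the EXACT IDENTITY `stretchI (F a) = a²·Ew + stretchI C` (`stretchI_F`); the
amplitude `aW = −(1 + |stretchI C|/Ew) < 0` gives `0 < stretchI (F aW)` (`stretchI_F_aW_pos`). Last, conjugation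
by the mirror (tree `fderiv_conj_linearIsometryEquiv`, `IsometryInvariance`): `D(R∘V∘R)(x)u = R(DV(Rx)(Ru))`,
`curl (R∘V∘R)(x) = −R (curl V (Rx))`, `sI (R∘V∘R)(x) = sI V (Rx)`.

WHAT THIS IS NOT: not a claim about NS regularity or blow-up; not a claim about any author beyond the typed
locator.
-/

-- The summit's canonical theorem namespace repeats the summit name (single-conjunct summit).
set_option linter.dupNamespace false

noncomputable section

open Set MeasureTheory Filter Topology Function Metric
open scoped RealInnerProductSpace ContDiff

namespace Summit.NavierStokesRegularity.NavierStokesRegularity.Theorems.LucardoOlivaes2026GI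

open Literature.Analysis.FluidPDE
open Literature.Claims.NS.LucardoOlivaes2026
open Literature.Claims.NS.Chae2007 (IsDatum)
open Summit.NavierStokesRegularity.NavierStokesRegularity.Theorems.Bledsoe2026 (w x₀ w_contDiff
  w_differentiable w_hasCompactSupport divergence_w curl_w_x₀_ne_zero curl_w_eq_zero w_eq_zero
  fderiv_w_eq_zero w_apply_zero w_apply_one w_apply_two curl_w_apply_two G G_eq_zero Dlin Dlin_apply
  curl_Dlin inner_Dlin_of_horizontal contDiff_coord hasFDerivAt_radial)

/-! ### The stretching integrand -/

/-- The integrand of `stretchI`: `sI v y = ⟪curl v y, Dv(y) (curl v y)⟫` (so `stretchI v = ∫ sI v`). -/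
def sI (v : E3 → E3) (y : E3) : ℝ := ⟪curl v y, fderiv ℝ v y (curl v y)⟫

/-- kit lemma (plumbing) [folklore] -/ theorem stretchI_eq (v : E3 → E3) : stretchI v = ∫ y, sI v y := rfl

/-- kit lemma (plumbing) [folklore] -/ theorem continuous_sI {v : E3 → E3} (hv : ContDiff ℝ ∞ v) : Continuous (sI v) :=
  (continuous_curl (hv.of_le (mod_cast le_top))).inner
    ((hv.continuous_fderiv (by simp)).clm_apply (continuous_curl (hv.of_le (mod_cast le_top))))

/-- kit lemma (plumbing) [folklore] -/ theorem hasCompactSupport_sI {v : E3 → E3} (hv : HasCompactSupport v) : HasCompactSupport (sI v) :=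
  (hasCompactSupport_curl hv).mono fun y hy => by
    contrapose! hy
    simp [sI, Function.notMem_support.1 hy]

/-- kit lemma (plumbing) [folklore] -/ theorem integrable_sI {v : E3 → E3} (hv : ContDiff ℝ ∞ v) (hc : HasCompactSupport v) :
    Integrable (sI v) :=
  (continuous_sI hv).integrable_of_hasCompactSupport (hasCompactSupport_sI hc)

/-! ### The ring `w` (tree, C86): even ⇒ `stretchI w = 0`; its enstrophy `Ew > 0` -/

/-- The derivative of an even field is odd (no differentiability needed). -/
theorem fderiv_at_neg_of_even {v : E3 → E3} (hv : ∀ x, v (-x) = v x) (x : E3) :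
    fderiv ℝ v (-x) = -fderiv ℝ v x := by
  set N : E3 ≃L[ℝ] E3 := ContinuousLinearEquiv.neg ℝ with hN
  have hcomp : v ∘ (N : E3 → E3) = v := by
    funext y; simp [hN, hv]
  have h := N.comp_right_fderiv (f := v) (x := -x)
  rw [hcomp] at h
  have hx : N (-x) = x := by simp [hN]
  rw [hx] at h
  ext u i
  rw [h]
  simp [hN]

/-- kit lemma (plumbing) [folklore] -/ theorem curl_at_neg_of_even {v : E3 → E3} (hv : ∀ x, v (-x) = v x) (x : E3) :
    curl v (-x) = -curl v x := by
  ext i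
  fin_cases i <;> simp [curl, fderiv_at_neg_of_even hv x] <;> ring

/-- kit lemma (plumbing) [folklore] -/ theorem sI_odd_of_even {v : E3 → E3} (hv : ∀ x, v (-x) = v x) (x : E3) : sI v (-x) = -sI v x := by
  rw [sI, sI, curl_at_neg_of_even hv, fderiv_at_neg_of_even hv]
  simp [inner_neg_left]

/-- `stretchI v = 0` for every even field `v`. -/
theorem stretchI_eq_zero_of_even {v : E3 → E3} (hv : ∀ x, v (-x) = v x) : stretchI v = 0 := by
  have hmp := (LinearIsometryEquiv.neg ℝ (E := E3)).measurePreserving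
  have hme := (LinearIsometryEquiv.neg ℝ (E := E3)).toHomeomorph.measurableEmbedding
  have h1 : ∫ x, sI v (-x) = ∫ x, sI v x := hmp.integral_comp hme (sI v)
  have h2 : (fun x => sI v (-x)) = fun x => -sI v x := funext (sI_odd_of_even hv)
  rw [h2, integral_neg] at h1
  rw [stretchI_eq]; linarith

/-- kit lemma (plumbing) [folklore] -/ theorem w_even (x : E3) : w (-x) = w x := by
  ext i
  fin_cases i <;>
    simp [Summit.NavierStokesRegularity.NavierStokesRegularity.Theorems.Bledsoe2026.w, norm_neg]

/-- kit lemma (plumbing) [folklore] -/ theorem stretchI_w : stretchI w = 0 := stretchI_eq_zero_of_even w_even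

/-- kit lemma (plumbing) [folklore] -/ theorem continuous_curl_w : Continuous (curl w) :=
  continuous_curl (w_contDiff.of_le (mod_cast le_top))

/-- kit lemma (plumbing) [folklore] -/ theorem hasCompactSupport_curl_w : HasCompactSupport (curl w) := by
  refine HasCompactSupport.intro (isCompact_closedBall (0 : E3) 1) fun x hx => curl_w_eq_zero ?_
  have h1 : 1 < ‖x‖ := by simpa [mem_closedBall, dist_zero_right] using hx
  nlinarith

/-- The enstrophy of the ring. -/
def Ew : ℝ := ∫ x, ‖curl w x‖ ^ 2

/-- kit lemma (plumbing) [folklore] -/ theorem hasCompactSupport_normsq_curl_w : HasCompactSupport fun x => ‖curl w x‖ ^ 2 := by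
  have : (fun x => ‖curl w x‖ ^ 2) = (fun x => ‖curl w x‖) * fun x => ‖curl w x‖ := by
    ext x; simp [sq]
  rw [this]; exact hasCompactSupport_curl_w.norm.mul_right

/-- kit lemma (plumbing) [folklore] -/ theorem integrable_normsq_curl_w : Integrable fun x => ‖curl w x‖ ^ 2 :=
  (continuous_curl_w.norm.pow 2).integrable_of_hasCompactSupport hasCompactSupport_normsq_curl_w

/-- kit lemma (plumbing) [folklore] -/ theorem Ew_pos : 0 < Ew :=
  (continuous_curl_w.norm.pow 2).integral_pos_of_hasCompactSupport_nonneg_nonzero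
    hasCompactSupport_normsq_curl_w (fun _ => sq_nonneg _)
    (pow_ne_zero 2 (norm_ne_zero_iff.2 curl_w_x₀_ne_zero))

/-- NO SWIRL for the ring. -/
theorem inner_w_etheta (y : E3) : ⟪w y, WithLp.toLp 2 ![-y 1, y 0, 0]⟫ = 0 := by
  rw [inner_eq3, w_apply_zero, w_apply_one]
  simp
  ring

/-- AXIS VALUES of the ring: `w (0,0,ζ) ₂ = 2 G(ζ²) ≥ 0`. -/
theorem w_axis_two (ζ : ℝ) : w (EuclideanSpace.single 2 ζ) 2 = 2 * G (ζ ^ 2) := by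
  rw [w_apply_two]
  simp

/-- kit lemma (plumbing) [folklore] -/ theorem G_nonneg {t : ℝ} (ht : 0 ≤ t) : 0 ≤ G t :=
  mul_nonneg ht (Real.smoothTransition.nonneg _)

/-! ### The blob `F a = C + a • w` -/

/-- The upper blob before translation: cavity plus `a` times the ring. -/
def F (a : ℝ) (y : E3) : E3 := C y + a • w y

/-- kit lemma (plumbing) [folklore] -/ theorem F_contDiff (a : ℝ) : ContDiff ℝ ∞ (F a) := C_contDiff.add (w_contDiff.const_smul a)

/-- kit lemma (plumbing) [folklore] -/ theorem F_differentiable (a : ℝ) : Differentiable ℝ (F a) := (F_contDiff a).differentiable (by simp)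

/-- kit lemma (plumbing) [folklore] -/ theorem hasFDerivAt_aw (a : ℝ) (y : E3) : HasFDerivAt (fun z => a • w z) (a • fderiv ℝ w y) y :=
  (w_differentiable y).hasFDerivAt.const_smul a

/-- kit lemma (plumbing) [folklore] -/ theorem fderiv_F (a : ℝ) (y : E3) : fderiv ℝ (F a) y = fderiv ℝ C y + a • fderiv ℝ w y := by
  show fderiv ℝ (fun y => C y + a • w y) y = _
  rw [fderiv_fun_add (C_differentiable y) (hasFDerivAt_aw a y).differentiableAt, (hasFDerivAt_aw a y).fderiv]

/-- kit lemma (plumbing) [folklore] -/ theorem curl_F (a : ℝ) (y : E3) : curl (F a) y = curl C y + a • curl w y := by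
  show curl (fun y => C y + a • w y) y = _
  rw [curl_add (C_differentiable y) (hasFDerivAt_aw a y).differentiableAt, curl_const_smul (w_differentiable y)]

/-- kit lemma (plumbing) [folklore] -/ theorem F_eq_zero {a : ℝ} {y : E3} (hy : 2 < ‖y‖ ^ 2) : F a y = 0 := by
  simp [F, C_eq_zero hy, w_eq_zero (by linarith : 1 / 2 < ‖y‖ ^ 2)]

/-- kit lemma (plumbing) [folklore] -/ theorem fderiv_F_eq_zero {a : ℝ} {y : E3} (hy : 2 < ‖y‖ ^ 2) : fderiv ℝ (F a) y = 0 := by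
  rw [fderiv_F, fderiv_C_eq_zero hy, fderiv_w_eq_zero (by linarith : 1 / 2 < ‖y‖ ^ 2)]
  ext1 v
  simp [_root_.smul_apply]

/-- kit lemma (plumbing) [folklore] -/ theorem curl_F_eq_zero {a : ℝ} {y : E3} (hy : 2 < ‖y‖ ^ 2) : curl (F a) y = 0 :=
  curl_eq_zero_of_fderiv_eq_zero (fderiv_F_eq_zero hy)

/-- kit lemma (plumbing) [folklore] -/ theorem F_eq_zero_of_norm {a : ℝ} {y : E3} (hy : 3 / 2 < ‖y‖) : F a y = 0 :=
  F_eq_zero (by nlinarith)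

/-- kit lemma (plumbing) [folklore] -/ theorem F_hasCompactSupport (a : ℝ) : HasCompactSupport (F a) := by
  refine HasCompactSupport.intro (isCompact_closedBall (0 : E3) 2) fun y hy => F_eq_zero_of_norm ?_
  have h1 : 2 < ‖y‖ := by simpa [mem_closedBall, dist_zero_right] using hy
  linarith

/-- kit lemma (plumbing) [folklore] -/ theorem divergence_w' (y : E3) : VectorCalculus.divergence w y = 0 := divergence_w y

/-- kit lemma (plumbing) [folklore] -/ theorem divergence_F (a : ℝ) (y : E3) : VectorCalculus.divergence (F a) y = 0 := by
  have h1 := divergence_C y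
  have h2 := divergence_w' y
  simp only [VectorCalculus.divergence] at h1 h2 ⊢
  rw [fderiv_F]
  simp [h1, h2]

/-- On the ring's vorticity the ring stretches itself at rate `a²‖ω‖²` inside the cavity; ZONE IDENTITY. -/
theorem sI_F (a : ℝ) (y : E3) : sI (F a) y = a ^ 2 * ‖curl w y‖ ^ 2 + a ^ 3 * sI w y + sI C y := by
  by_cases hy : ‖y‖ ^ 2 < 1
  · have hD : ⟪curl w y, Dlin (curl w y)⟫ = ‖curl w y‖ ^ 2 := by
      rw [real_inner_comm]; exact inner_Dlin_of_horizontal (curl_w_apply_two y)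
    rw [sI, sI, sI, curl_F, fderiv_F, curl_C_of_lt_one hy, fderiv_C hy, zero_add, inner_zero_left]
    simp only [_root_.add_apply, _root_.smul_apply, map_smul, inner_add_right, inner_smul_left,
      inner_smul_right, hD, RCLike.conj_to_real]
    ring
  · have hy' : 1 / 2 < ‖y‖ ^ 2 := by linarith [not_lt.1 hy]
    simp [sI, curl_F, fderiv_F, curl_w_eq_zero hy', fderiv_w_eq_zero hy']

/-- **EXACT IDENTITY for the blob**: `stretchI (C + a w) = a² Ew + stretchI C`. -/
theorem stretchI_F (a : ℝ) : stretchI (F a) = a ^ 2 * Ew + stretchI C := by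
  have hi1 : Integrable fun y => a ^ 2 * ‖curl w y‖ ^ 2 := integrable_normsq_curl_w.const_mul _
  have hi2 : Integrable fun y => a ^ 3 * sI w y := (integrable_sI w_contDiff w_hasCompactSupport).const_mul _
  have hi12 : Integrable fun y => a ^ 2 * ‖curl w y‖ ^ 2 + a ^ 3 * sI w y := hi1.add hi2
  have hi3 : Integrable (sI C) := integrable_sI C_contDiff C_hasCompactSupport
  have hw : ∫ y, sI w y = 0 := stretchI_w
  rw [stretchI_eq, stretchI_eq]
  simp_rw [sI_F]
  rw [integral_add hi12 hi3, integral_add hi1 hi2, integral_const_mul, integral_const_mul, hw, mul_zero,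
    add_zero]
  rfl

/-- The ring amplitude: negative, `|a| ≥ 1`, and large enough to dominate `stretchI C`. -/
def aW : ℝ := -(1 + |stretchI C| / Ew)

/-- kit lemma (plumbing) [folklore] -/ theorem aW_le : aW ≤ -1 := by
  have := div_nonneg (abs_nonneg (stretchI C)) Ew_pos.le
  unfold aW; linarith

/-- kit lemma (plumbing) [folklore] -/ theorem aW_neg : aW < 0 := by linarith [aW_le]

/-- kit lemma (plumbing) [folklore] -/ theorem stretchI_F_aW_pos : 0 < stretchI (F aW) := by
  rw [stretchI_F]
  have hE := Ew_pos
  have h1 : aW ^ 2 * Ew ≥ (1 + |stretchI C| / Ew) * Ew := by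
    have hsq : aW ^ 2 = (1 + |stretchI C| / Ew) ^ 2 := by unfold aW; ring
    have hge : 1 ≤ 1 + |stretchI C| / Ew := by
      have := div_nonneg (abs_nonneg (stretchI C)) Ew_pos.le; linarith
    rw [hsq]
    nlinarith [mul_nonneg (sub_nonneg.2 hge) (mul_nonneg (le_trans zero_le_one hge) hE.le)]
  have h2 : (1 + |stretchI C| / Ew) * Ew = Ew + |stretchI C| := by field_simp
  have h3 := neg_abs_le (stretchI C)
  linarith

/-! ### Conjugation by the mirror: derivative, curl, stretching integrand -/

/-- kit lemma (plumbing) [folklore] -/ theorem mirrorZ_neg (x : E3) : mirrorZ (-x) = -mirrorZ x := by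
  ext i; fin_cases i <;> simp

/-- kit lemma (plumbing) [folklore] -/ theorem mirrorZ_single_zero : mirrorZ (EuclideanSpace.single 0 (1 : ℝ)) = EuclideanSpace.single 0 1 := by
  ext i; fin_cases i <;> simp

/-- kit lemma (plumbing) [folklore] -/ theorem mirrorZ_single_one : mirrorZ (EuclideanSpace.single 1 (1 : ℝ)) = EuclideanSpace.single 1 1 := by
  ext i; fin_cases i <;> simp

/-- kit lemma (plumbing) [folklore] -/ theorem mirrorZ_single_two : mirrorZ (EuclideanSpace.single 2 (1 : ℝ)) = -EuclideanSpace.single 2 1 := by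
  ext i; fin_cases i <;> simp

/-- Chain rule for `z ↦ R (V (R z))`, apply form. -/
theorem fderiv_conj_mirror_apply (V : E3 → E3) (x u : E3) :
    fderiv ℝ (fun z => mirrorZ (V (mirrorZ z))) x u = mirrorZ (fderiv ℝ V (mirrorZ x) (mirrorZ u)) := by
  have h := fderiv_conj_linearIsometryEquiv Ri V x
  simp only [Ri_apply, Ri_symm_apply] at h
  rw [h]
  simp

/-- `curl (R ∘ V ∘ R)(x) = −R (curl V (R x))` (a reflection reverses vorticity). -/
theorem curl_conj_mirror (V : E3 → E3) (x : E3) :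
    curl (fun z => mirrorZ (V (mirrorZ z))) x = -mirrorZ (curl V (mirrorZ x)) := by
  ext i
  fin_cases i <;>
    simp [curl, fderiv_conj_mirror_apply, mirrorZ_single_zero, mirrorZ_single_one, mirrorZ_single_two,
      map_neg] <;> ring

/-- kit lemma (plumbing) [folklore] -/ theorem sI_conj_mirror (V : E3 → E3) (x : E3) :
    sI (fun z => mirrorZ (V (mirrorZ z))) x = sI V (mirrorZ x) := by
  rw [sI, sI, curl_conj_mirror, fderiv_conj_mirror_apply]
  simp [mirrorZ_neg, map_neg, inner_mirrorZ_mirrorZ]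

/-- kit lemma (plumbing) [folklore] -/ theorem curl_congr_nhds {u v : E3 → E3} {x : E3} (h : u =ᶠ[𝓝 x] v) : curl u x = curl v x := by
  rw [curl_eq_curlCLM, curl_eq_curlCLM, h.fderiv_eq]

/-- kit lemma (plumbing) [folklore] -/ theorem sI_congr_nhds {u v : E3 → E3} {x : E3} (h : u =ᶠ[𝓝 x] v) : sI u x = sI v x := by
  rw [sI, sI, curl_congr_nhds h, h.fderiv_eq]

/-- kit lemma (plumbing) [folklore] -/ theorem sI_zero_fun (x : E3) : sI (fun _ => (0 : E3)) x = 0 := by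
  simp [sI, curl_fun_zero]

end Summit.NavierStokesRegularity.NavierStokesRegularity.Theorems.LucardoOlivaes2026GI

end
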